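import Literature.MathematicalPhysics.QuantumFieldTheory.Balaban1983to89.B4Prop31TorusFamily
import Literature.MathematicalPhysics.QuantumFieldTheory.Balaban1983to89.B4Prop31Window

/-!
# `Balaban1983to89.B4Prop31TorusWindow` — [Balaban1983RegularityDecay] «Proposition 3.1′ of [2]» (1.21)–(1.22) p. 574
# ON TORUS REGIONS WITH WINDOW-UNIFORM CONSTANTS: the torus form family of `B4Prop31TorusFamily` indexed over the window
# `a_k ∈ [a₋, a₊]`, `m² ∈ [0, m²₊]`, and the typed leaf `B4.Prop31Printed (torusFormSettingW …)` with one `γ₀`, one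
# threshold `e₁`, one `C(α)` for the whole window (the famF words F-torusF AND F-windowF of YM-PLAN row N01 at once)

statement-level skeleton of published theorems with citation tags; proofs where landed; nothing here is a claim about
the Yang–Mills mass gap

CITATION HEADER.  T. Bałaban, *Regularity and decay of lattice Green's functions*, Commun. Math. Phys. **89** (1983)
571–597, doi:10.1007/bf01214744 [Balaban1983RegularityDecay] (cell paper B4; held text
`paper:balaban1983-cmp89-regularity-decay`, journal page = PDF page + 570; p. 574 (1.21)–(1.22), p. 572 «operators on
subsets of a torus T_η», p. 573 (1.14) «a_k is a constant proportional to a»).  Cell `pub-ymgap`, Track-A seat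
`pub-ymgap-dag-n01-b` gen 0 (node N01; cross-read XREAD-B4 v0.5 §7: famF scope (f1) «ℤ^{d+1}-not-torus» and flag
F-windowF «certified PER VALUE of (a_k, m²), not uniformly over the a_k-window»).  File 3 of the seat's famF series over
`B4Prop31TorusFamily` (torus family at fixed `(a, m²)`) and `B4Prop31Window` (lattice family, window-uniform).  One
dictionary `structure` + three small `def`s (`torusFormSettingW` reducible, the two chart index maps) + theorems; no
`Prop`-valued fact, no `sorry`, axioms standard.  USED BY NAME: `B4Prop31TorusFamily.{TorusFormInstance, torusFormSetting,
chart₀, chart₁, form_chart₀_le, form_chart₁_le, l2_chart₁, reg121_chart₀, reg121_chart₁, tcovDiffSq_le_charts}`,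
`B4Prop31Window.{RegularFormIdxW, regularFormSettingW, prop31Printed_regularWindow}`, p23 `B2Lemma24KerOmegaTorusShift.σYι`.

WHAT IS PRINTED (p. 574, verbatim).  «Proposition 3.1′ of [2]: Let Ω be a sum of unit blocks … then there exists a
positive constant γ₀ depending on d only, such that for e sufficiently small ⟨φ, Δ^{(k)}(Ω,A)φ⟩ ≥ γ₀(Σ_{⟨x,x′⟩⊂Ω^{(k)}}
|U(A(⟨x,x′⟩))φ(x′) − φ(x)|² + m²Σ_{x∈Ω^{(k)}}|φ(x)|²) − O(1)e^{2−α}Σ_{x∈Ω^{(k)}}|φ(x)|² (1.22) for arbitrary α > 0 and a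
constant O(1) depending on α and the other constants, but independent of Ω, k, A, and for an arbitrary function φ.»

WHAT THIS MODULE PROVES (all in full).
* §1 `TorusFormIdxW`, `torusFormSettingW` (member = `torusFormSetting F a_k m² C a₀ p i`, `rfl`), `chartW₀`, `chartW₁`
  (the two fundamental-domain charts of a member as members of the lattice window family, same `(a_k, m²)`).
* §2 **`prop31Printed_torusWindow`**: `B4.Prop31Printed (torusFormSettingW F a₋ a₊ m²₊ C a₀ p)` for every Lipschitz
  orthogonal flow, `0 < a₋ ≤ a₊`, `C, a₀ ≥ 0`, `p > 0` — `γ₀` = half of `B4Prop31Window`'s window constant, the same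
  `e₁` and `C(α)`; the two-chart argument of `B4Prop31TorusFamily.prop31Printed_torusRegions` verbatim with the window
  theorem as the lattice input; `prop31Printed_torusWindow_exp` (printed link variables (1.2)); `torusWindow_antecedents_met`
  (non-vacuity below every threshold).
HONEST SCOPE.  As files 1–2: the two-fundamental-domain route and the monotonicity of p35's constants are this lineage's
devices; `γ₀` depends on `(d, a₋, m²₊)` (print: «on d only»); `P_ν ≥ 2`, fine period `≥ 3` unprinted conventions; no
family of record is re-pinned.  Count-neutral for YM-PLAN (typed 28∕28 · discharged 0∕28 unmoved); nothing here
concerns the continuum, ℝ⁴, OS axioms, a mass gap or the Clay problem.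
-/

namespace Literature.MathematicalPhysics.QuantumFieldTheory.Balaban1983to89.B4Prop31TorusWindow

open Matrix Finset
open Literature.MathematicalPhysics.QuantumFieldTheory.Balaban1983to89
open Literature.MathematicalPhysics.QuantumFieldTheory.Balaban1983to89.B4GaugeCovariance
open Literature.MathematicalPhysics.QuantumFieldTheory.Balaban1983to89.B4Lower18 (fineDom)
open Literature.MathematicalPhysics.QuantumFieldTheory.Balaban1983to89.B4Lower18Regular (e1 dotProduct_self_nonneg')
open Literature.MathematicalPhysics.QuantumFieldTheory.Balaban1983to89.B4Reflection242 (boxDom mem_boxDom)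
open Literature.MathematicalPhysics.QuantumFieldTheory.Balaban1983to89.B4TorusRegionOp (per twrap)
open Literature.MathematicalPhysics.QuantumFieldTheory.Balaban1983to89.B4Prop31Regular (RegularFormInstance
  regularFormSetting)
open Literature.MathematicalPhysics.QuantumFieldTheory.Balaban1983to89.B4Prop31TorusFamily
open Literature.MathematicalPhysics.QuantumFieldTheory.Balaban1983to89.B4Prop31Window (RegularFormIdxW
  regularFormSettingW prop31Printed_regularWindow)
open Literature.MathematicalPhysics.QuantumFieldTheory.Balaban1983to89.B2Lemma24KerOmegaTorusShift (σYι)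
open Literature.MathematicalPhysics.QuantumFieldTheory.Balaban1983to89.B4Eq12ExpFlow (expFlow expFlow_ell_nonneg
  expFlow_lipschitz)

noncomputable section

variable {d : ℕ} {ι : Type} [Fintype ι] [DecidableEq ι]

/-! ## §1. The torus family over the window of running parameters; chart indices -/

/-- AN INDEX of the torus window family: `a_k ∈ [a₋, a₊]`, `m² ∈ [0, m²₊]`, and a torus instance of
`B4Prop31TorusFamily`. [cite: Balaban1983RegularityDecay, p. 573 (1.14), p. 574 (1.21)–(1.22), p. 572 «operators on subsets of a torus T_η», dictionary] -/
structure TorusFormIdxW (d : ℕ) (amin aplus m2plus : ℝ) where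
  /-- the running coefficient `a_k` -/
  ak : ℝ
  hak : amin ≤ ak
  hak' : ak ≤ aplus
  /-- the mass `m²` -/
  m2 : ℝ
  hm2 : 0 ≤ m2
  hm2' : m2 ≤ m2plus
  /-- the torus instance: mesh, unit torus, labels of `Ω`, charge, torus field -/
  inst : TorusFormInstance d

/-- **THE TORUS WINDOW FAMILY** for «Proposition 3.1′ of [2]»: the member at `(a_k, m², i)` IS
`torusFormSetting F a_k m² C a₀ p i`. [cite: Balaban1983RegularityDecay, p. 574 (1.21)–(1.22) with p. 572 (torus), dictionary] -/
@[reducible] def torusFormSettingW (F : OrthFlow ι) (amin aplus m2plus C a₀ p : ℝ)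
    (i : TorusFormIdxW d amin aplus m2plus) : B4.FormSetting :=
  torusFormSetting F i.ak i.m2 C a₀ p i.inst

/-- the torus window member is the fixed-parameter torus member (definitional). [cite: Balaban1983RegularityDecay, p. 574 (1.22), dictionary] -/
theorem torusFormSettingW_eq (F : OrthFlow ι) (amin aplus m2plus C a₀ p : ℝ)
    (i : TorusFormIdxW d amin aplus m2plus) :
    torusFormSettingW F amin aplus m2plus C a₀ p i = torusFormSetting F i.ak i.m2 C a₀ p i.inst := rfl

/-- CHART 0 of a torus window member, as a member of the lattice window family (same `(a_k, m²)`).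
[cite: Balaban1983RegularityDecay, p. 572 «a rectangular parallelepiped in ηZ^d with periodic conditions», dictionary] -/
def chartW₀ {amin aplus m2plus : ℝ} (i : TorusFormIdxW d amin aplus m2plus) : RegularFormIdxW d amin aplus m2plus where
  ak := i.ak
  hak := i.hak
  hak' := i.hak'
  m2 := i.m2
  hm2 := i.hm2
  hm2' := i.hm2'
  inst := chart₀ i.inst

/-- CHART 1 (the torus translated by `𝟙`) of a torus window member, as a member of the lattice window family.
[cite: Balaban1983RegularityDecay, p. 572 «periodic conditions», dictionary] -/
def chartW₁ {amin aplus m2plus : ℝ} (i : TorusFormIdxW d amin aplus m2plus) : RegularFormIdxW d amin aplus m2plus where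
  ak := i.ak
  hak := i.hak
  hak' := i.hak'
  m2 := i.m2
  hm2 := i.hm2
  hm2' := i.hm2'
  inst := chart₁ i.inst

/-! ## §2. «Proposition 3.1′ of [2]» on the torus window family -/

section Main

variable (F : OrthFlow ι) {ℓ : ℝ} (hℓ : 0 ≤ ℓ)
  (hLip : ∀ t (v : ι → ℝ), ((F.U t - 1) *ᵥ v) ⬝ᵥ ((F.U t - 1) *ᵥ v) ≤ (ℓ * t) ^ 2 * (v ⬝ᵥ v))

include hℓ hLip in
/-- **THEOREM («PROPOSITION 3.1′ OF [2]» TYPED ON THE TORUS WINDOW FAMILY: ONE `γ₀`, ONE `e₁`, ONE `C(α)` FOR ALL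
`a_k ∈ [a₋, a₊]`, `m² ∈ [0, m²₊]`, ALL MESHES, ALL TORI, ALL TORUS REGIONS (THE WHOLE TORUS INCLUDED), ALL CHARGES, ALL
TORUS FIELDS `A ≠ 0`)**: for a Lipschitz orthogonal flow, `0 < a₋ ≤ a₊`, `C, a₀ ≥ 0`, `p > 0`, the verbatim-typed
`B4.Prop31Printed` HOLDS on `torusFormSettingW F a₋ a₊ m²₊ C a₀ p` — `γ₀` = half of `B4Prop31Window`'s, the same `e₁`,
`C(α)`; two fundamental domains (`form_chart₀_le`, `form_chart₁_le`, `tcovDiffSq_le_charts` of `B4Prop31TorusFamily`) fed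
with the window-uniform lattice theorem `prop31Printed_regularWindow`.  HONEST LABEL: `γ₀` depends on `(d, a₋, m²₊)`.
[cite: Balaban1983RegularityDecay, Prop. 3.1′ of [2] (1.21)–(1.22) p.574; p.572 «operators on subsets of a torus T_η»] -/
theorem prop31Printed_torusWindow {amin aplus m2plus : ℝ} (ha : 0 < amin) (hap : amin ≤ aplus) {C : ℝ} (hC : 0 ≤ C)
    {a₀ : ℝ} (ha₀ : 0 ≤ a₀) {p : ℝ} (hp : 0 < p) :
    B4.Prop31Printed (torusFormSettingW (d := d) F amin aplus m2plus C a₀ p) := by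
  obtain ⟨γ₀, e₁, hγ₀, he₁, H⟩ :=
    prop31Printed_regularWindow (d := d) (m2plus := m2plus) F hℓ hLip ha hap hC ha₀ hp
  refine ⟨γ₀ / 2, e₁, half_pos hγ₀, he₁, fun α hα => ?_⟩
  obtain ⟨C', hC', H'⟩ := H α hα
  refine ⟨C', hC', ?_⟩
  intro i _ hreg he hle ψ
  have ha0 : 0 < i.ak := lt_of_lt_of_le ha i.hak
  change 0 < i.inst.e at he
  change i.inst.e ≤ e₁ at hle
  change ∀ x ∈ fineDom i.inst.n i.inst.ΩT, ∀ μ ν : Fin (d + 1),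
    |i.inst.Ac (twrap i.inst.n i.inst.P (x + e1 μ)) ν - i.inst.Ac x ν| ≤ C * B2.pFn a₀ p i.inst.e / i.inst.n at hreg
  -- the window lattice theorem on the two charts
  have h0 := H' (chartW₀ i) trivial (reg121_chart₀ i.inst hreg) he hle ψ
  have h1 := H' (chartW₁ i) trivial (reg121_chart₁ i.inst hreg) he hle
    (ψ ∘ (σYι ι i.inst.P (fun _ => 1) i.inst.hΩ i.inst.hP).symm)
  have hf0 := form_chart₀_le F i.ak i.m2 C a₀ p i.inst ha0 i.hm2 ψ
  have hf1 := form_chart₁_le F i.ak i.m2 C a₀ p i.inst ha0 i.hm2 ψ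
  have hD := tcovDiffSq_le_charts (F := F) (a := i.ak) (m2 := i.m2) (C := C) (a₀ := a₀) (p := p) (i := i.inst) ψ
  have hl2 : (regularFormSetting F i.ak i.m2 C a₀ p (chart₁ i.inst)).l2sq
      (ψ ∘ (σYι ι i.inst.P (fun _ => 1) i.inst.hΩ i.inst.hP).symm) = ψ ⬝ᵥ ψ := l2_chart₁ i.inst ψ
  set T := (torusFormSetting F i.ak i.m2 C a₀ p i.inst).form ψ with hT
  set D := (torusFormSetting F i.ak i.m2 C a₀ p i.inst).covDiffSq ψ with hDdef
  set D0 := (regularFormSetting F i.ak i.m2 C a₀ p (chart₀ i.inst)).covDiffSq ψ with hD0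
  set D1 := (regularFormSetting F i.ak i.m2 C a₀ p (chart₁ i.inst)).covDiffSq
    (ψ ∘ (σYι ι i.inst.P (fun _ => 1) i.inst.hΩ i.inst.hP).symm) with hD1
  change γ₀ * (D0 + i.m2 * (ψ ⬝ᵥ ψ)) - C' * i.inst.e ^ ((2 : ℝ) - α) * (ψ ⬝ᵥ ψ)
    ≤ (regularFormSetting F i.ak i.m2 C a₀ p (chart₀ i.inst)).form ψ at h0
  change γ₀ * (D1 + i.m2 * (regularFormSetting F i.ak i.m2 C a₀ p (chart₁ i.inst)).l2sq
      (ψ ∘ (σYι ι i.inst.P (fun _ => 1) i.inst.hΩ i.inst.hP).symm))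
    - C' * i.inst.e ^ ((2 : ℝ) - α) * (regularFormSetting F i.ak i.m2 C a₀ p (chart₁ i.inst)).l2sq
      (ψ ∘ (σYι ι i.inst.P (fun _ => 1) i.inst.hΩ i.inst.hP).symm)
    ≤ (regularFormSetting F i.ak i.m2 C a₀ p (chart₁ i.inst)).form
      (ψ ∘ (σYι ι i.inst.P (fun _ => 1) i.inst.hΩ i.inst.hP).symm) at h1
  rw [hl2] at h1
  change γ₀ / 2 * (D + i.m2 * (ψ ⬝ᵥ ψ)) - C' * i.inst.e ^ ((2 : ℝ) - α) * (ψ ⬝ᵥ ψ) ≤ T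
  have hS : 0 ≤ ψ ⬝ᵥ ψ := dotProduct_self_nonneg' ψ
  have hmS : 0 ≤ i.m2 * (ψ ⬝ᵥ ψ) := mul_nonneg i.hm2 hS
  have hDD : γ₀ / 2 * D ≤ γ₀ / 2 * (D0 + D1) := mul_le_mul_of_nonneg_left hD (half_pos hγ₀).le
  have hMM : γ₀ / 2 * (i.m2 * (ψ ⬝ᵥ ψ)) ≤ γ₀ * (i.m2 * (ψ ⬝ᵥ ψ)) := by nlinarith
  nlinarith [h0, h1, hf0, hf1, hDD, hMM]

/-- «Proposition 3.1′ of [2]» on the torus window family FOR THE PRINTED LINK VARIABLES (1.2) `U(A) = e^{qeηA}`, ANY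
antisymmetric `q`. [cite: Balaban1983RegularityDecay, (1.2) p.572; Prop. 3.1′ of [2] (1.21)–(1.22) p.574] -/
theorem prop31Printed_torusWindow_exp (q : Matrix ι ι ℝ) (hq : qᵀ = -q) {amin aplus m2plus : ℝ} (ha : 0 < amin)
    (hap : amin ≤ aplus) {C : ℝ} (hC : 0 ≤ C) {a₀ : ℝ} (ha₀ : 0 ≤ a₀) {p : ℝ} (hp : 0 < p) :
    B4.Prop31Printed (torusFormSettingW (d := d) (expFlow q hq) amin aplus m2plus C a₀ p) :=
  prop31Printed_torusWindow (expFlow q hq) (expFlow_ell_nonneg q) (expFlow_lipschitz q hq) ha hap hC ha₀ hp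

end Main

/-! ## §3. Non-vacuity -/

/-- **NON-VACUITY OF THE TORUS WINDOW FAMILY**: for every threshold `e₁ > 0` (and `a₋ ≤ a₊`, `m²₊ ≥ 0`) the family has
a member whose antecedents `unitBlocks`, `reg121`, `0 < e ≤ e₁` hold (the zero field on one unit block of `(ℤ/3)^{d+1}`,
mesh `1`, `a_k = a₋`, `m² = 0`). [cite: Balaban1983RegularityDecay, Prop. 3.1′ of [2] (1.21) p.574 «for e sufficiently small», dictionary] -/
theorem torusWindow_antecedents_met (F : OrthFlow ι) {amin aplus m2plus : ℝ} (hap : amin ≤ aplus) (hm2p : 0 ≤ m2plus)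
    {C a₀ : ℝ} (hC : 0 ≤ C) (ha₀ : 0 ≤ a₀) (p : ℝ) {e₁ : ℝ} (he₁ : 0 < e₁) :
    ∃ i : TorusFormIdxW d amin aplus m2plus,
      (torusFormSettingW (d := d) F amin aplus m2plus C a₀ p i).unitBlocks ∧
      (torusFormSettingW (d := d) F amin aplus m2plus C a₀ p i).reg121 ∧
      0 < (torusFormSettingW (d := d) F amin aplus m2plus C a₀ p i).e ∧
      (torusFormSettingW (d := d) F amin aplus m2plus C a₀ p i).e ≤ e₁ := by
  obtain ⟨j, hj1, hj2, hj3, hj4⟩ := torus_antecedents_met (d := d) F amin 0 hC ha₀ p he₁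
  exact ⟨⟨amin, le_rfl, hap, 0, le_rfl, hm2p, j⟩, hj1, hj2, hj3, hj4⟩

end

end Literature.MathematicalPhysics.QuantumFieldTheory.Balaban1983to89.B4Prop31TorusWindow
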